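import Summits.RiemannHypothesis.RiemannHypothesis.Theses.SignCone
import Literature.NumberTheory.LFunctions.WeilCriterionProofs
import Literature.NumberTheory.LFunctions.WeilArchimedeanPositivityHolds

/-!
# `SignCone.SignConeDuality` (crux stmt-RiemannHypothesis-16304): which hypothesis carries content
# (negative-side support, cdisprove cycle 1)

Support file of the crux disprover (seat `refuter-cdisprove-stmt-RiemannHypothesis-16304-0`);
companion of the crux workfile `Cruxes/SignConeDuality/Disproof.lean` (§§B1–B3 there). No
definitions: `Dual a` below always means the VERBATIM conclusion of `SignConeDuality` at cutoff `a`
(= the antecedent of crux `ConeMagnification` at `a`), spelled out inline (long lines = item text).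

The crux is `∀ a > 0, Hyp a → Dual a` (`Hyp a` = the unit-slack sign-cone inequality at cutoff `a`,
the body of the route target `SignConeInequality` at `a`). Load-bearing map, all sorry-free:

* `signConeDuality_dual_of_nonpos` — `a ≤ 0 → Dual a`: the guard `0 < a` is decoration (only
  `g = 0` is admissible; every term vanishes).
* `signConeDuality_dualWith_vonMangoldt_of_weilPositivityOn` — Weil positivity on `[-a, a]` gives the
  unit-slack inequality with the TRUE weight `c = Λ` (the item's fake Weil form at `c = Λ` IS the
  tree's `weilQuadratic`, definitionally); hence
  `signConeDuality_dual_of_le_log_two_half` — `a ≤ (log 2)/2 → Dual a` UNCONDITIONALLY (Yoshida 1992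
  Thm 1, in-tree `weilPositivityOn_log_two_half_holds`) and `signConeDuality_smallCutoff` — the crux
  restricted to cutoffs `a ≤ (log 2)/2` is a theorem whose proof ignores `Hyp a`: there the
  hypothesis is NOT load-bearing.
* `signConeDuality_dual_of_riemannHypothesis` — `RH → ∀ a, Dual a` (`c = Λ`, in-tree
  `weil_criterion_holds`); with crux `ConeMagnification` conversely `(∀ a > 0, Dual a) → RH`, so
  `signConeDuality_withoutHyp_iff_riemannHypothesis`: modulo `ConeMagnification` the crux WITH ITS
  HYPOTHESIS DELETED is equivalent to the summit. Consequences for the record: (i) no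
  `_false_without_Hyp` refutation can exist short of `¬RH`; (ii) all arithmetic of the implication
  sits in `Hyp a` for `a > (log 2)/2` — the duality step `Hyp a → Dual a` is RH-free convex geometry,
  consistent with the item's stamp "provable-now".
-/

noncomputable section

open scoped BigOperators ArithmeticFunction.vonMangoldt
open MeasureTheory Set Literature.NumberTheory.LFunctions

namespace Summit.RiemannHypothesis.RiemannHypothesis.Theorems.SignConeDuality.Negative

/-- **The guard `0 < a` is decoration.** For `a ≤ 0`, `Dual a` (verbatim conclusion of
`SignConeDuality` at `a`) holds with `c = 0`: a continuous `g` with `tsupport g ⊆ [-a, a]` has open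
support inside `interior [-a, a] = ∅`, so `g = 0` and every term of the fake Weil form vanishes.
[folklore] -/
theorem signConeDuality_dual_of_nonpos :
    ∀ a : ℝ, a ≤ 0 →
      ∃ c : ℕ → ℝ, (∀ n, 0 ≤ c n) ∧ c 1 = 0 ∧ ∀ g : ℝ → ℂ, (ContDiff ℝ ((⊤ : ℕ∞) : WithTop ℕ∞) g ∧ HasCompactSupport g) → tsupport g ⊆ Set.Icc (-a) a → let G : ℝ → ℂ := MeasureTheory.convolution g (fun u => (starRingEnd ℂ) (g (-u))) (ContinuousLinearMap.mul ℂ ℂ) MeasureTheory.MeasureSpace.volume; let M : ℂ → ℂ := fun s => ∫ u : ℝ, G u * Complex.exp ((s - 1 / 2) * u); -(∫ t, ‖g t‖ ^ 2) ≤ (M 0 + M 1 + ((1 / (2 * Real.pi) : ℂ) * (∫ t : ℝ, M (1 / 2 + t * Complex.I) * ((Complex.digamma (1 / 4 + t / 2 * Complex.I)).re : ℂ)) - G 0 * (Real.log Real.pi : ℂ)) - ∑' n : ℕ, ((c n : ℝ) : ℂ) / (Real.sqrt n : ℂ) * (G (Real.log n) + G (-Real.log n))).re := by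
  intro a ha
  refine ⟨fun _ => 0, fun _ => le_rfl, rfl, ?_⟩
  intro g hg hsupp
  have hg0 : g = 0 := by
    funext x
    by_contra hx
    have h1 : Function.support g ⊆ interior (Icc (-a) a) :=
      interior_maximal ((subset_tsupport g).trans hsupp) hg.1.continuous.isOpen_support
    rw [interior_Icc] at h1
    have hx' := h1 (Function.mem_support.2 hx)
    linarith [hx'.1, hx'.2]
  subst hg0
  simp [MeasureTheory.zero_convolution]

/-- **Transport at the true weight.** If Weil positivity holds on the truncated cone `[-a, a]`
(`WeilPositivityOn a`), then the fake Weil form with weight `c = Λ` has unit slack on every test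
supported in `[-a, a]` — indeed slack `0`: the item's expression at `c = Λ` is DEFINITIONALLY
`weilPolarTerm G + weilArchTerm G - weilPrimeTerm G = weilQuadratic g` (`G = g ⋆ g̃`), and
`∫‖g‖² ≥ 0`. [folklore] -/
theorem signConeDuality_dualWith_vonMangoldt_of_weilPositivityOn :
    ∀ a : ℝ, WeilPositivityOn a →
      ∀ g : ℝ → ℂ, (ContDiff ℝ ((⊤ : ℕ∞) : WithTop ℕ∞) g ∧ HasCompactSupport g) → tsupport g ⊆ Set.Icc (-a) a → let G : ℝ → ℂ := MeasureTheory.convolution g (fun u => (starRingEnd ℂ) (g (-u))) (ContinuousLinearMap.mul ℂ ℂ) MeasureTheory.MeasureSpace.volume; let M : ℂ → ℂ := fun s => ∫ u : ℝ, G u * Complex.exp ((s - 1 / 2) * u); -(∫ t, ‖g t‖ ^ 2) ≤ (M 0 + M 1 + ((1 / (2 * Real.pi) : ℂ) * (∫ t : ℝ, M (1 / 2 + t * Complex.I) * ((Complex.digamma (1 / 4 + t / 2 * Complex.I)).re : ℂ)) - G 0 * (Real.log Real.pi : ℂ)) - ∑' n : ℕ, ((Λ n : ℝ) : ℂ) /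 (Real.sqrt n : ℂ) * (G (Real.log n) + G (-Real.log n))).re := by
  intro a h g hg hsupp
  have hW : 0 ≤ (weilQuadratic g).re := h g hg hsupp
  have hN : 0 ≤ ∫ t : ℝ, ‖g t‖ ^ 2 := integral_nonneg fun _ => by positivity
  show -(∫ t : ℝ, ‖g t‖ ^ 2) ≤
    (weilPolarTerm (weilConv g (weilReflect g)) + weilArchTerm (weilConv g (weilReflect g)) -
      weilPrimeTerm (weilConv g (weilReflect g))).re
  have hQ : weilPolarTerm (weilConv g (weilReflect g)) + weilArchTerm (weilConv g (weilReflect g)) -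
      weilPrimeTerm (weilConv g (weilReflect g)) = weilQuadratic g := by
    simp only [weilQuadratic, weilFunctional]
    ring
  rw [hQ]
  linarith

/-- `Dual a` (verbatim conclusion of `SignConeDuality` at `a`) from Weil positivity on `[-a, a]`,
with the witness `c = Λ` (`Λ ≥ 0`, `Λ 1 = 0`). [folklore] -/
theorem signConeDuality_dual_of_weilPositivityOn :
    ∀ a : ℝ, WeilPositivityOn a →
      ∃ c : ℕ → ℝ, (∀ n, 0 ≤ c n) ∧ c 1 = 0 ∧ ∀ g : ℝ → ℂ, (ContDiff ℝ ((⊤ : ℕ∞) : WithTop ℕ∞) g ∧ HasCompactSupport g) → tsupport g ⊆ Set.Icc (-a) a → let G : ℝ → ℂ := MeasureTheory.convolution g (fun u => (starRingEnd ℂ) (g (-u))) (ContinuousLinearMap.mul ℂ ℂ) MeasureTheory.MeasureSpace.volume; let M : ℂ → ℂ := fun s => ∫ u : ℝ, G u * Complex.exp ((s - 1 / 2) * u); -(∫ t, ‖g t‖ ^ 2) ≤ (M 0 + M 1 + ((1 / (2 * Real.pi) : ℂ) * (∫ t : ℝ, M (1 / 2 + t * Complex.I) * ((Complex.digamma (1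 / 4 + t / 2 * Complex.I)).re : ℂ)) - G 0 * (Real.log Real.pi : ℂ)) - ∑' n : ℕ, ((c n : ℝ) : ℂ) / (Real.sqrt n : ℂ) * (G (Real.log n) + G (-Real.log n))).re :=
  fun a h => ⟨fun n => Λ n, fun _ => ArithmeticFunction.vonMangoldt_nonneg,
    by simp [ArithmeticFunction.vonMangoldt_apply_one],
    signConeDuality_dualWith_vonMangoldt_of_weilPositivityOn a h⟩

/-- **Unconditional at small cutoffs.** For `a ≤ (log 2)/2`, `Dual a` holds outright (Yoshida 1992
Thm 1 = in-tree `weilPositivityOn_log_two_half_holds`, weight `c = Λ`). [folklore] -/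
theorem signConeDuality_dual_of_le_log_two_half :
    ∀ a : ℝ, a ≤ Real.log 2 / 2 →
      ∃ c : ℕ → ℝ, (∀ n, 0 ≤ c n) ∧ c 1 = 0 ∧ ∀ g : ℝ → ℂ, (ContDiff ℝ ((⊤ : ℕ∞) : WithTop ℕ∞) g ∧ HasCompactSupport g) → tsupport g ⊆ Set.Icc (-a) a → let G : ℝ → ℂ := MeasureTheory.convolution g (fun u => (starRingEnd ℂ) (g (-u))) (ContinuousLinearMap.mul ℂ ℂ) MeasureTheory.MeasureSpace.volume; let M : ℂ → ℂ := fun s => ∫ u : ℝ, G u * Complex.exp ((s - 1 / 2) * u); -(∫ t, ‖g t‖ ^ 2) ≤ (M 0 + M 1 + ((1 / (2 * Real.pi) : ℂ) * (∫ t : ℝ, M (1 / 2 + t * Complex.I) * ((Complex.digamma (1 / 4 + t / 2 * Complex.I)).re : ℂ)) - G 0 * (Real.log Real.pi : ℂ)) - ∑' n : ℕ, ((c n : ℝ) : ℂ) / (Real.sqrt n : ℂ) * (G (Real.log n) + G (-Real.log n))).re :=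
  fun a ha => signConeDuality_dual_of_weilPositivityOn a fun g hg hsupp =>
    weilPositivityOn_log_two_half_holds g hg (hsupp.trans (Icc_subset_Icc (by linarith) ha))

/-- **At small cutoffs the hypothesis is not load-bearing.** The crux `SignConeDuality` RESTRICTED to
cutoffs `a ≤ (log 2)/2` (its `0 < a` replaced by `a ≤ (log 2)/2`; hypothesis and conclusion
verbatim) is a theorem whose proof never uses the hypothesis. [folklore] -/
theorem signConeDuality_smallCutoff :
    ∀ a : ℝ, a ≤ Real.log 2 / 2 →
      (∀ (k : ℕ) (g : Fin k → ℝ → ℂ), (∀ i, (ContDiff ℝ ((⊤ : ℕ∞) : WithTop ℕ∞) (g i) ∧ HasCompactSupport (g i)) ∧ tsupport (g i) ⊆ Set.Icc (-a) a) → let F : ℝ → ℂ := fun t => ∑ i, MeasureTheory.convolution (g i) (fun u => (starRingEnd ℂ) ((g i) (-u))) (ContinuousLinearMap.mul ℂ ℂ) MeasureTheory.MeasureSpace.volume t; (∀ n : ℕ, 2 ≤ n → 0 ≤ (F (Real.log n)).re) → let M : ℂ → ℂ := fun s => ∫ u : ℝ, F u * Complex.exp ((s - 1 / 2) * u); -(F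 0).re ≤ (M 0 + M 1 + ((1 / (2 * Real.pi) : ℂ) * (∫ t : ℝ, M (1 / 2 + t * Complex.I) * ((Complex.digamma (1 / 4 + t / 2 * Complex.I)).re : ℂ)) - F 0 * (Real.log Real.pi : ℂ))).re) →
      ∃ c : ℕ → ℝ, (∀ n, 0 ≤ c n) ∧ c 1 = 0 ∧ ∀ g : ℝ → ℂ, (ContDiff ℝ ((⊤ : ℕ∞) : WithTop ℕ∞) g ∧ HasCompactSupport g) → tsupport g ⊆ Set.Icc (-a) a → let G : ℝ → ℂ := MeasureTheory.convolution g (fun u => (starRingEnd ℂ) (g (-u))) (ContinuousLinearMap.mul ℂ ℂ) MeasureTheory.MeasureSpace.volume; let M : ℂ → ℂ := fun s => ∫ u : ℝ, G u * Complex.exp ((s - 1 / 2) * u); -(∫ t, ‖g t‖ ^ 2) ≤ (M 0 + M 1 + ((1 / (2 * Real.pi) : ℂ) * (∫ t : ℝ, M (1 / 2 + t * Complex.I) * ((Complex.digamma (1 / 4 + t / 2 * Complex.I)).re : ℂ)) - G 0 * (Real.log Real.pi : ℂ)) - ∑' n : ℕ, ((c n : ℝ) : ℂ) / (Real.sqrt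 n : ℂ) * (G (Real.log n) + G (-Real.log n))).re :=
  fun a ha _ => signConeDuality_dual_of_le_log_two_half a ha

/-- **Deleting the hypothesis leaves an RH-true statement.** `RH → Dual a` at EVERY cutoff, with
`c = Λ` (easy half of Weil's criterion, in-tree `weil_criterion_holds`). Hence no refutation of the
hypothesis-free form `∀ a > 0, Dual a` exists short of `¬RH`. [folklore] -/
theorem signConeDuality_dual_of_riemannHypothesis :
    Summit.RiemannHypothesis → ∀ a : ℝ,
      ∃ c : ℕ → ℝ, (∀ n, 0 ≤ c n) ∧ c 1 = 0 ∧ ∀ g : ℝ → ℂ, (ContDiff ℝ ((⊤ : ℕ∞) : WithTop ℕ∞) g ∧ HasCompactSupport g) → tsupport g ⊆ Set.Icc (-a) a → let G : ℝ → ℂ := MeasureTheory.convolution g (fun u => (starRingEnd ℂ) (g (-u))) (ContinuousLinearMap.mul ℂ ℂ) MeasureTheory.MeasureSpace.volume; let M : ℂ → ℂ := fun s => ∫ u : ℝ, G u * Complex.exp ((s - 1 / 2) * u); -(∫ t, ‖g t‖ ^ 2) ≤ (M 0 + M 1 + ((1 / (2 * Real.pi) : ℂ) * (∫ t : ℝ,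 M (1 / 2 + t * Complex.I) * ((Complex.digamma (1 / 4 + t / 2 * Complex.I)).re : ℂ)) - G 0 * (Real.log Real.pi : ℂ)) - ∑' n : ℕ, ((c n : ℝ) : ℂ) / (Real.sqrt n : ℂ) * (G (Real.log n) + G (-Real.log n))).re :=
  fun hRH a => signConeDuality_dual_of_weilPositivityOn a fun g hg _ => weil_criterion_holds.1 hRH g hg

/-- **Modulo crux `ConeMagnification`, the hypothesis-free form is equivalent to the summit.**
`(∀ a > 0, Dual a) ↔ RH` given `ConeMagnification` (whose antecedent `∀ a > 0, Dual a` is,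
verbatim). So the duality step `Hyp a → Dual a` neither adds nor loses RH content: it all sits in
`Hyp a`, `a > (log 2)/2`. [folklore] -/
theorem signConeDuality_withoutHyp_iff_riemannHypothesis
    (hMag : Theses.SignCone.ConeMagnification) :
    (∀ a : ℝ, 0 < a →
        ∃ c : ℕ → ℝ, (∀ n, 0 ≤ c n) ∧ c 1 = 0 ∧ ∀ g : ℝ → ℂ, (ContDiff ℝ ((⊤ : ℕ∞) : WithTop ℕ∞) g ∧ HasCompactSupport g) → tsupport g ⊆ Set.Icc (-a) a → let G : ℝ → ℂ := MeasureTheory.convolution g (fun u => (starRingEnd ℂ) (g (-u))) (ContinuousLinearMap.mul ℂ ℂ) MeasureTheory.MeasureSpace.volume; let M : ℂ → ℂ := fun s => ∫ u : ℝ, G u * Complex.exp ((s - 1 / 2) * u); -(∫ t, ‖g t‖ ^ 2) ≤ (M 0 + M 1 + ((1 / (2 * Real.pi) : ℂ) * (∫ t : ℝ, M (1 / 2 + t * Complex.I) * ((Complex.digamma (1 / 4 + t / 2 * Complex.I)).re : ℂ)) - G 0 * (Real.log Real.pi : ℂ)) - ∑' n : ℕ, ((c n : ℝ) : ℂ) /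 (Real.sqrt n : ℂ) * (G (Real.log n) + G (-Real.log n))).re) ↔
      Summit.RiemannHypothesis :=
  ⟨fun h => hMag h, fun hRH a _ => signConeDuality_dual_of_riemannHypothesis hRH a⟩

end Summit.RiemannHypothesis.RiemannHypothesis.Theorems.SignConeDuality.Negative

end
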